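import Summits.CriticalPhenomena.SAWScalingLimit.Theorems.SAWDevelopingMapHexTightOfAtoms
import Summits.CriticalPhenomena.SAWScalingLimit.Theorems.SAWDevelopingMapHexTightNetNear
import HarnessLib

/-!
# The boundary atom of `HexTight` does not see the marked points (stmt-CriticalPhenomena-5423)

Crux `Summit.CriticalPhenomena.SAWScalingLimit.Theses.SAWDevelopingMap.HexTight` (eventual tightness of the critical
hexagonal SAW laws), line `reversal-virgin-disc`, skeleton r9, seat c4
(`prover-line-stmt-CriticalPhenomena-5423-c4-0`).

By `hexTight_iff_interiorThin_and_onFrontier` (p111202) the crux is equivalent to per-shell, rate-free tightness of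
the number of separate shell traversals of the SAW polyline on (i) thin interior shells and (ii) thin shells centred
ON the Jordan curve. This file removes from (ii) every shell whose closed outer disc contains a marked point
`D.pt 0` or `D.pt 1` (the limits of the endpoints `a δ`, `b δ`), i.e. the shells on which the endpoints FORCE a
traversal: the boundary atom is needed only far from the marked points.

* `window_disjoint` — the radius windows `((3R' + 13ρ)/16, (13R' + 3ρ)/16)` of two outer radii in ratio `≥ 5`
  are disjoint;
* `onFrontierAspect_of_interiorThin_of_onFrontierFar` — **the dodge**: for an open `Ω` with thin-interior per-shell
  tightness, per-shell tightness on thin frontier-centred shells whose closed outer disc avoids two given points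
  `p₀, p₁` gives per-shell tightness on every frontier-centred shell of aspect `100`: localize the sub-shell
  `D(x; ρ, R')` for the one radius `R' ∈ {R, R/5, R/25}` whose window contains neither `dist x p₀` nor `dist x p₁`
  (`BoundaryOnFrontier.stub_netNear`, the net lemma with the frontier hypothesis asked only within `10w` of the
  middle circle); its frontier net shells `D(x''; 11w, (R'-ρ)/4)` then have `dist x'' pᵢ ≥ 5(R'-ρ)/16 - 10w >
  (R'-ρ)/4`;
* `onFrontier_of_interiorThin_of_onFrontierFar` — hence (aspect removed by `perShellTight_thin_of_onFrontierAspect`)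
  the full on-frontier atom;
* `hexTight_of_pinchDecay_of_onFrontierFar` — the r9 composition of the line: `PinchDecay` + on-frontier per-shell
  tightness far from the marked points ⇒ `HexTight` (CONDITIONAL: both hypotheses are open a-priori estimates);
* `hexTight_iff_interiorThin_and_onFrontierFar` — **`HexTight` ⟺ (thin-interior per-shell tightness) ∧
  (on-frontier per-shell tightness far from the marked points)**.

References: M. Aizenman, A. Burchard, Duke Math. J. 99 (1999) §1–2 [AizenmanBurchardDuke1999];
H. Duminil-Copin, S. Smirnov, Ann. of Math. 175 (2012) [DuminilCopinSmirnov2012].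
-/

noncomputable section

open scoped BigOperators Classical ENNReal NNReal
open MeasureTheory Filter Topology Set Metric
open Literature.Probability.LatticeModels Literature.Probability.RandomPlanarGeometry
  Literature.Probability.RandomPlanarGeometry.SAW

namespace Summit.CriticalPhenomena.SAWScalingLimit.Theorems.HexTight.BoundaryOnFrontier

open Summit.CriticalPhenomena.SAWScalingLimit.Theorems.HexTight.ExponentBootstrap
open Summit.CriticalPhenomena.SAWScalingLimit.Theorems.HexTight.Reversal

/-- **Radius windows of radii in ratio `≥ 5` are disjoint**: if `d` lies above the lower end of the window
`((3R₁ + 13ρ)/16, (13R₁ + 3ρ)/16)` of `R₁`, it lies above the upper end of the window of any `0 ≤ R₂ ≤ R₁/5`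
(`ρ ≥ 0`). -/
theorem window_disjoint {ρ d R₁ R₂ : ℝ} (hρ : 0 ≤ ρ) (hR₂ : 0 ≤ R₂) (h : 5 * R₂ ≤ R₁)
    (h₁ : (3 * R₁ + 13 * ρ) / 16 < d) (h₂ : d < (13 * R₂ + 3 * ρ) / 16) : False := by
  have h3 : 13 * R₂ + 3 * ρ ≤ 3 * R₁ + 13 * ρ := by linarith
  have h4 : (13 * R₂ + 3 * ρ) / 16 ≤ (3 * R₁ + 13 * ρ) / 16 :=
    div_le_div_of_nonneg_right h3 (by norm_num : (0 : ℝ) ≤ 16)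
  linarith

/-- **The dodge.** Let `Ω` be open with thin-interior per-shell tightness of the traversal number, and suppose
per-shell tightness on the thin shells `D(x; ρ, R)` centred at frontier points `x` whose closed outer disc avoids
two given points `p₀, p₁` (`R < dist x pᵢ`). Then per-shell tightness holds on every shell of aspect `100` centred
on the frontier: among the outer radii `R, R/5, R/25` of the (thin) sub-shells `D(x; ρ, R')` one has both
distances `dist x pᵢ` off the window `((3R' + 13ρ)/16, (13R' + 3ρ)/16)` (`window_disjoint`); localize that sub-shell
with `stub_netNear` (`M = ⌈176π m/hh⌉₊ + 1`, `η₁ = η/2`, `β = η/(2M)`): its frontier net shells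
`D(x''; 11w, (R'-ρ)/4)`, `|dist x'' x - (ρ+R')/2| ≤ 10w`, `88w < (R'-ρ)/2`, satisfy `(R'-ρ)/4 < dist x'' pᵢ`, so
the far hypothesis pays for them; finally `HasTraversals k x ρ R ⇒ HasTraversals k x ρ R'`. -/
theorem onFrontierAspect_of_interiorThin_of_onFrontierFar :
    ∀ (p₀ p₁ : ℂ) (Ω : Set ℂ), IsOpen Ω → ∀ (a b : ℝ → HexVertex),
      (∀ (x : ℂ) (ρ R : ℝ), 0 < ρ → 4 * ρ < R → R ≤ 1 → Metric.closedBall x R ⊆ Ω → ∀ η : ℝ, 0 < η →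
        ∃ (k : ℕ) (δ₁ : ℝ), 0 < δ₁ ∧ ∀ δ ∈ Set.Ioc (0 : ℝ) δ₁, δ ≤ ρ →
          hexSAWLaw Ω δ (a δ) (b δ)
            {γ | (⟨γ.walk.toCurve fun v => (δ : ℂ) * hexCenter v⟩ : Curve ℂ).HasTraversals k x ρ R} ≤
            ENNReal.ofReal η) →
      (∀ (x : ℂ) (ρ R : ℝ), 0 < ρ → 4 * ρ < R → R ≤ 1 → x ∈ frontier Ω →
        R < dist x p₀ → R < dist x p₁ → ∀ η : ℝ, 0 < η →
        ∃ (k : ℕ) (δ₁ : ℝ), 0 < δ₁ ∧ ∀ δ ∈ Set.Ioc (0 : ℝ) δ₁, δ ≤ ρ →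
          hexSAWLaw Ω δ (a δ) (b δ)
            {γ | (⟨γ.walk.toCurve fun v => (δ : ℂ) * hexCenter v⟩ : Curve ℂ).HasTraversals k x ρ R} ≤
            ENNReal.ofReal η) →
      ∀ (x : ℂ) (ρ R : ℝ), 0 < ρ → 100 * ρ < R → R ≤ 1 → x ∈ frontier Ω → ∀ η : ℝ, 0 < η →
        ∃ (k : ℕ) (δ₁ : ℝ), 0 < δ₁ ∧ ∀ δ ∈ Set.Ioc (0 : ℝ) δ₁, δ ≤ ρ →
          hexSAWLaw Ω δ (a δ) (b δ)
            {γ | (⟨γ.walk.toCurve fun v => (δ : ℂ) * hexCenter v⟩ : Curve ℂ).HasTraversals k x ρ R} ≤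
            ENNReal.ofReal η := by
  intro p₀ p₁ Ω hΩ a b hI hFar x ρ R hρ h100 hR1 _hx η hη
  -- the two marked distances and the windows
  set d₀ : ℝ := dist x p₀ with hd₀
  set d₁ : ℝ := dist x p₁ with hd₁
  let bad : ℝ → ℝ → Prop := fun d R' => (3 * R' + 13 * ρ) / 16 < d ∧ d < (13 * R' + 3 * ρ) / 16
  -- one of the three radii `R, R/5, R/25` is good for both distances
  obtain ⟨R', hR'R, hR'low, hg₀, hg₁⟩ : ∃ R' : ℝ, R' ≤ R ∧ R / 25 ≤ R' ∧ ¬ bad d₀ R' ∧ ¬ bad d₁ R' := by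
    have hR0 : 0 < R := by linarith
    have k01 : ∀ d, bad d R → bad d (R / 5) → False := fun d h h' =>
      window_disjoint hρ.le (by positivity) (by linarith) h.1 h'.2
    have k02 : ∀ d, bad d R → bad d (R / 25) → False := fun d h h' =>
      window_disjoint hρ.le (by positivity) (by linarith) h.1 h'.2
    have k12 : ∀ d, bad d (R / 5) → bad d (R / 25) → False := fun d h h' =>
      window_disjoint hρ.le (by positivity) (by linarith) h.1 h'.2
    by_cases h0 : ¬ bad d₀ R ∧ ¬ bad d₁ R
    · exact ⟨R, le_rfl, by linarith, h0.1, h0.2⟩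
    by_cases h1 : ¬ bad d₀ (R / 5) ∧ ¬ bad d₁ (R / 5)
    · exact ⟨R / 5, by linarith, by linarith, h1.1, h1.2⟩
    refine ⟨R / 25, by linarith, le_rfl, fun h2 => ?_, fun h2 => ?_⟩
    · -- `d₀` bad at `R/25` ⇒ good at `R` and `R/5` ⇒ `d₁` bad at both ⇒ contradiction
      have a0 : ¬ bad d₀ R := fun h => k02 d₀ h h2
      have a1 : ¬ bad d₀ (R / 5) := fun h => k12 d₀ h h2
      have b0 : bad d₁ R := by by_contra h; exact h0 ⟨a0, h⟩
      have b1 : bad d₁ (R / 5) := by by_contra h; exact h1 ⟨a1, h⟩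
      exact k01 d₁ b0 b1
    · have a0 : ¬ bad d₁ R := fun h => k02 d₁ h h2
      have a1 : ¬ bad d₁ (R / 5) := fun h => k12 d₁ h h2
      have b0 : bad d₀ R := by by_contra h; exact h0 ⟨h, a0⟩
      have b1 : bad d₀ (R / 5) := by by_contra h; exact h1 ⟨h, a1⟩
      exact k01 d₀ b0 b1
  -- the sub-shell `D(x; ρ, R')` is thin
  have h4' : 4 * ρ < R' := by linarith
  have hR'1 : R' ≤ 1 := hR'R.trans hR1
  have hρR' : ρ < R' := by linarith
  -- middle radius `m`, half width `hh`, net size `M`, net mesh `w` (all as plain reals)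
  obtain ⟨m, hm⟩ : ∃ m : ℝ, m = (ρ + R') / 2 := ⟨_, rfl⟩
  obtain ⟨hh, hhh⟩ : ∃ hh : ℝ, hh = (R' - ρ) / 2 := ⟨_, rfl⟩
  have hmpos : 0 < m := by rw [hm]; linarith
  have hhpos : 0 < hh := by rw [hhh]; linarith
  obtain ⟨M, hMdef⟩ : ∃ M : ℕ, M = ⌈176 * Real.pi * m / hh⌉₊ + 1 := ⟨_, rfl⟩
  have hMm : 176 * Real.pi * m / hh < M := by
    rw [hMdef, Nat.cast_add, Nat.cast_one]
    exact lt_of_le_of_lt (Nat.le_ceil _) (lt_add_one _)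
  have hM : 176 * Real.pi * ((ρ + R') / 2) / ((R' - ρ) / 2) < M := by rwa [← hm, ← hhh]
  have hMpos : (0 : ℝ) < M := lt_of_le_of_lt (by positivity) hMm
  have hMne : (M : ℝ) ≠ 0 := hMpos.ne'
  obtain ⟨w, hw⟩ : ∃ w : ℝ, w = 2 * Real.pi * ((ρ + R') / 2) / M := ⟨_, rfl⟩
  have hwm : w = 2 * Real.pi * m / M := by rw [hw, hm]
  have hwpos : 0 < w := by rw [hwm]; positivity
  have h88 : 88 * w < hh := by
    have h1 : 176 * Real.pi * m < M * hh := by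
      have := (div_lt_iff₀ hhpos).1 hMm; linarith [mul_comm (M : ℝ) hh]
    rw [hwm, show 88 * (2 * Real.pi * m / M) = 176 * Real.pi * m / M by ring, div_lt_iff₀ hMpos]
    linarith [mul_comm (M : ℝ) hh]
  -- the frontier hypothesis near the middle circle, from `hFar`
  have hβ : 0 < η / (2 * M) := div_pos hη (mul_pos two_pos hMpos)
  have hF : ∀ x'' ∈ frontier Ω,
      (ρ + R') / 2 - 10 * (2 * Real.pi * ((ρ + R') / 2) / M) ≤ dist x'' x →
      dist x'' x ≤ (ρ + R') / 2 + 10 * (2 * Real.pi * ((ρ + R') / 2) / M) →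
      ∃ (k : ℕ) (δ₁ : ℝ), 0 < δ₁ ∧ ∀ δ ∈ Set.Ioc (0 : ℝ) δ₁,
        δ ≤ 11 * (2 * Real.pi * ((ρ + R') / 2) / M) →
        hexSAWLaw Ω δ (a δ) (b δ)
          {γ | (⟨γ.walk.toCurve fun v => (δ : ℂ) * hexCenter v⟩ : Curve ℂ).HasTraversals k x''
            (11 * (2 * Real.pi * ((ρ + R') / 2) / M)) ((R' - ρ) / 4)} ≤ ENNReal.ofReal (η / (2 * M)) := by
    intro x'' hx'' hlo hhi
    rw [← hw] at hlo hhi ⊢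
    -- both marked points are far from `x''`
    have hfar : ∀ (p : ℂ), ¬ bad (dist x p) R' → (R' - ρ) / 4 < dist x'' p := by
      intro p hp
      have hp' : dist x p ≤ (3 * R' + 13 * ρ) / 16 ∨ (13 * R' + 3 * ρ) / 16 ≤ dist x p := by
        by_cases hA : (3 * R' + 13 * ρ) / 16 < dist x p
        · right
          by_contra hB
          exact hp ⟨hA, lt_of_not_ge hB⟩
        · left
          exact le_of_not_gt hA
      have t1 : dist x p ≤ dist x x'' + dist x'' p := dist_triangle _ _ _
      have t2 : dist x x'' ≤ dist x p + dist p x'' := dist_triangle _ _ _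
      rw [dist_comm x x''] at t1 t2
      rw [dist_comm p x''] at t2
      rcases hp' with hlow | hhigh
      · -- `d ≤ m - 5hh/8` and `dist x'' x ≥ m - 10 w`
        linarith
      · -- `d ≥ m + 5hh/8` and `dist x'' x ≤ m + 10 w`
        linarith
    obtain ⟨k, δ₁, hδ₁, hk⟩ := hFar x'' (11 * w) ((R' - ρ) / 4) (by positivity) (by linarith)
      (by linarith) hx'' (hfar p₀ hg₀) (hfar p₁ hg₁) (η / (2 * M)) hβ
    exact ⟨k, δ₁, hδ₁, fun δ hδ hδw => hk δ hδ hδw⟩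
  obtain ⟨k, δ₁, hδ₁, hk⟩ := stub_netNear Ω hΩ a b hI x ρ R' hρ h4' hR'1 M hM (η / (2 * M)) (η / 2) hβ.le
    (half_pos hη) hF
  have htot : η / 2 + M * (η / (2 * M)) = η := by field_simp; ring
  refine ⟨k, δ₁, hδ₁, fun δ hδ _ => ?_⟩
  calc hexSAWLaw Ω δ (a δ) (b δ) _
      ≤ hexSAWLaw Ω δ (a δ) (b δ)
          {γ | (⟨γ.walk.toCurve fun v => (δ : ℂ) * hexCenter v⟩ : Curve ℂ).HasTraversals k x ρ R'} :=
        measure_mono fun γ hγ => Curve.HasTraversals.mono' hγ le_rfl hR'R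
    _ ≤ ENNReal.ofReal (η / 2 + M * (η / (2 * M))) := hk δ hδ
    _ = ENNReal.ofReal η := by rw [htot]

/-- **On-frontier per-shell tightness far from two points + the interior atom ⇒ the full on-frontier atom** (for
an open `Ω`; aspect `100` removed by `perShellTight_thin_of_onFrontierAspect`, p117056). -/
theorem onFrontier_of_interiorThin_of_onFrontierFar :
    ∀ (p₀ p₁ : ℂ) (Ω : Set ℂ), IsOpen Ω → ∀ (a b : ℝ → HexVertex),
      (∀ (x : ℂ) (ρ R : ℝ), 0 < ρ → 4 * ρ < R → R ≤ 1 → Metric.closedBall x R ⊆ Ω → ∀ η : ℝ, 0 < η →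
        ∃ (k : ℕ) (δ₁ : ℝ), 0 < δ₁ ∧ ∀ δ ∈ Set.Ioc (0 : ℝ) δ₁, δ ≤ ρ →
          hexSAWLaw Ω δ (a δ) (b δ)
            {γ | (⟨γ.walk.toCurve fun v => (δ : ℂ) * hexCenter v⟩ : Curve ℂ).HasTraversals k x ρ R} ≤
            ENNReal.ofReal η) →
      (∀ (x : ℂ) (ρ R : ℝ), 0 < ρ → 4 * ρ < R → R ≤ 1 → x ∈ frontier Ω →
        R < dist x p₀ → R < dist x p₁ → ∀ η : ℝ, 0 < η →
        ∃ (k : ℕ) (δ₁ : ℝ), 0 < δ₁ ∧ ∀ δ ∈ Set.Ioc (0 : ℝ) δ₁, δ ≤ ρ →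
          hexSAWLaw Ω δ (a δ) (b δ)
            {γ | (⟨γ.walk.toCurve fun v => (δ : ℂ) * hexCenter v⟩ : Curve ℂ).HasTraversals k x ρ R} ≤
            ENNReal.ofReal η) →
      ∀ (x : ℂ) (ρ R : ℝ), 0 < ρ → 4 * ρ < R → R ≤ 1 → x ∈ frontier Ω → ∀ η : ℝ, 0 < η →
        ∃ (k : ℕ) (δ₁ : ℝ), 0 < δ₁ ∧ ∀ δ ∈ Set.Ioc (0 : ℝ) δ₁, δ ≤ ρ →
          hexSAWLaw Ω δ (a δ) (b δ)
            {γ | (⟨γ.walk.toCurve fun v => (δ : ℂ) * hexCenter v⟩ : Curve ℂ).HasTraversals k x ρ R} ≤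
            ENNReal.ofReal η :=
  fun p₀ p₁ Ω hΩ a b hI hFar x ρ R hρ h4 hR1 _ η hη =>
    perShellTight_thin_of_onFrontierAspect 100 (by norm_num) Ω hΩ a b hI
      (onFrontierAspect_of_interiorThin_of_onFrontierFar p₀ p₁ Ω hΩ a b hI hFar) x ρ R hρ h4 hR1 η hη

/-- **`HexTight` from pinch decay and on-frontier per-shell tightness FAR FROM THE MARKED POINTS** (the r9
composition of the line `reversal-virgin-disc`): the interior lattice-local atom `PinchDecay` (first hypothesis)
and per-shell rate-free tightness of the traversal number on thin shells centred on the Jordan curve whose closed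
outer disc contains neither marked point (second hypothesis) give the crux — `interiorThinPerShellTight_of_pinchDecay`
(p118066), the dodge at `p₀ = D.pt 0`, `p₁ = D.pt 1`, `hexTight_of_interiorThin_of_onFrontier` (p107072).
CONDITIONAL: both hypotheses are open a-priori estimates for the critical hexagonal SAW. -/
theorem hexTight_of_pinchDecay_of_onFrontierFar :
    (∃ (k : ℕ) (φ : ℝ → ℝ) (N₀ : ℝ), 1 ≤ k ∧ 0 < N₀ ∧ (∀ t : ℝ, 0 ≤ φ t) ∧
      (∀ ε : ℝ, 0 < ε → ∃ t₀ : ℝ, 0 < t₀ ∧ ∀ t : ℝ, 0 < t → t ≤ t₀ → φ t ≤ ε * t) ∧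
      ∀ (H : SimpleGraph HexVertex) (Λ : Finset HexVertex) (z₀ : ℂ) (η N : ℝ) (w w' : Sym2 HexVertex),
        N₀ ≤ N → 1 ≤ η → η ≤ N / 4 → IsVirgin H Λ z₀ N → Straddles Λ z₀ N w → Straddles Λ z₀ N w' →
        travMass H Λ w w' k z₀ η (N / 2) ≤ φ (η / N) * arcMass H Λ w w') →
    (∀ (D : DobrushinDomain) (a b : ℝ → HexVertex), IsEmbEndpointApprox hexGraph hexCenter D a b →
      ∀ (x : ℂ) (ρ R : ℝ), 0 < ρ → 4 * ρ < R → R ≤ 1 → x ∈ frontier D.carrier →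
        R < dist x (D.pt 0) → R < dist x (D.pt 1) → ∀ η : ℝ, 0 < η →
        ∃ (k : ℕ) (δ₁ : ℝ), 0 < δ₁ ∧ ∀ δ ∈ Set.Ioc (0 : ℝ) δ₁, δ ≤ ρ →
          hexSAWLaw D.carrier δ (a δ) (b δ)
            {γ | (⟨γ.walk.toCurve fun v => (δ : ℂ) * hexCenter v⟩ : Curve ℂ).HasTraversals k x ρ R} ≤
            ENNReal.ofReal η) →
    Summit.CriticalPhenomena.SAWScalingLimit.Theses.SAWDevelopingMap.HexTight := by
  intro hC hFar
  have hI := interiorThinPerShellTight_of_pinchDecay hC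
  exact hexTight_of_interiorThin_of_onFrontier hI fun D a b hab =>
    onFrontier_of_interiorThin_of_onFrontierFar (D.pt 0) (D.pt 1) D.carrier D.isOpen a b (hI D a b hab)
      (hFar D a b hab)

/-- **`HexTight` ⟺ (thin-interior per-shell tightness) ∧ (on-frontier per-shell tightness FAR FROM THE MARKED
POINTS).** Sharpening of `hexTight_iff_interiorThin_and_onFrontier` (p111202): in the boundary atom only the shells
`D(x; ρ, R)`, `x ∈ frontier D.carrier`, with `R < dist x (D.pt 0)` and `R < dist x (D.pt 1)` are needed (`⇐`: the
dodge; `⇒`: restriction of `perShellTight_of_hexTight`). -/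
theorem hexTight_iff_interiorThin_and_onFrontierFar :
    Summit.CriticalPhenomena.SAWScalingLimit.Theses.SAWDevelopingMap.HexTight ↔
    ((∀ (D : DobrushinDomain) (a b : ℝ → HexVertex), IsEmbEndpointApprox hexGraph hexCenter D a b →
      ∀ (x : ℂ) (ρ R : ℝ), 0 < ρ → 4 * ρ < R → R ≤ 1 → Metric.closedBall x R ⊆ D.carrier → ∀ η : ℝ, 0 < η →
        ∃ (k : ℕ) (δ₁ : ℝ), 0 < δ₁ ∧ ∀ δ ∈ Set.Ioc (0 : ℝ) δ₁, δ ≤ ρ →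
          hexSAWLaw D.carrier δ (a δ) (b δ)
            {γ | (⟨γ.walk.toCurve fun v => (δ : ℂ) * hexCenter v⟩ : Curve ℂ).HasTraversals k x ρ R} ≤
            ENNReal.ofReal η) ∧
     (∀ (D : DobrushinDomain) (a b : ℝ → HexVertex), IsEmbEndpointApprox hexGraph hexCenter D a b →
      ∀ (x : ℂ) (ρ R : ℝ), 0 < ρ → 4 * ρ < R → R ≤ 1 → x ∈ frontier D.carrier →
        R < dist x (D.pt 0) → R < dist x (D.pt 1) → ∀ η : ℝ, 0 < η →
        ∃ (k : ℕ) (δ₁ : ℝ), 0 < δ₁ ∧ ∀ δ ∈ Set.Ioc (0 : ℝ) δ₁, δ ≤ ρ →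
          hexSAWLaw D.carrier δ (a δ) (b δ)
            {γ | (⟨γ.walk.toCurve fun v => (δ : ℂ) * hexCenter v⟩ : Curve ℂ).HasTraversals k x ρ R} ≤
            ENNReal.ofReal η)) := by
  constructor
  · intro h
    obtain ⟨hI, hF⟩ := hexTight_iff_interiorThin_and_onFrontier.1 h
    exact ⟨hI, fun D a b hab x ρ R hρ h4 hR1 hx _ _ η hη => hF D a b hab x ρ R hρ h4 hR1 hx η hη⟩
  · rintro ⟨hI, hFar⟩
    exact hexTight_of_interiorThin_of_onFrontier hI fun D a b hab =>
      onFrontier_of_interiorThin_of_onFrontierFar (D.pt 0) (D.pt 1) D.carrier D.isOpen a b (hI D a b hab)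
        (hFar D a b hab)

end Summit.CriticalPhenomena.SAWScalingLimit.Theorems.HexTight.BoundaryOnFrontier

end
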